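import Summits.Ventures.LatticeQCDFlow.Scaling.ReplicaExchangeStarFloor
import Summits.Ventures.LatticeQCDFlow.Scaling.ExchangeSchemeHandoverCeiling

/-!
HONEST FRAMING: exact (Metropolis-corrected) sampling algorithms for lattice gauge theory; figures
of merit are autocorrelation/cost numbers at stated couplings and volumes; no continuum-physics
claim.

# WeightedHubSchemeFloor — THE LINEAR LAW IS ATTAINED: THE HUB EXCHANGE SCHEME WITH UPDATE WEIGHTS `w`,
# `P = t·GSw + (1−t)·prodKernel w M`, HAS `Gap ≥ 1/(3m(r²+1)/(t r⁴) + (r³+3K)/(r³γ₀(1−t)w_0))`; ALL UPDATES ON THE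
# HOT REPLICA AND IDENTICAL LEVELS: `min{t, γ₀(1−t)}/(10K) ≤ Gap ≤ t·min{μ_0(A),μ_0(Aᶜ)}/(Kv)` — ORDER `K⁻¹`
# EXACTLY, THE ORDER OF THE UNIVERSAL CEILING OF `Scaling/ExchangeSchemeHandoverCeiling` (lean-2 GEN-21, ours)

Venture-side (OURS).  Cell `lqcd-flow` (pub-lqcd), unit `pub-lqcd-lean-2-g21`, 2026-08-26.  Chapter I.
`Scaling/ExchangeSchemeHandoverCeiling` (H1): NO exchange scheme `P = t·Q + (1−t)·prodKernel w M` — any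
count-preserving exchange move `Q`, any allocation `w` of the single-replica updates — beats order `K` steps while `K`
cold replicas wait for the hot one (`Gap ≤ t·min{μ_0(A), μ_0(Aᶜ)}/(K·v)`); `Scaling/ReplicaExchangeStarFloor` (G3b):
the hub topology with UNIFORM weights relaxes in order `K²` steps.  Here the hub comparison of G3b is run with an
arbitrary probability vector `w` (`w_0 > 0`): the hot-update flow `(1−t)/(K+1)` becomes `(1−t)·w_0` and the floor
`1/(3m(r²+1)/(t r⁴) + (r³+3K)/(r³γ₀(1−t)w_0))` — ORDER `K⁻¹` when `w_0` is a constant: H1's linear law is the true order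
of the best exchange scheme over `K` passive cold replicas, attained by the simplest one (update the hot replica, hand
its configuration to a uniformly chosen cold replica by a Metropolis swap).  Objects: `ptGraphSwap μ e φ` of
`Scaling/ReplicaExchangeGraphSwap` with identity maps and a swap graph `e` of `m` edges containing the hub edges
`(0, k+1)`; legs `Scaling/ReplicaExchangeStarLegs`; bridge `Scaling/SpectralGapOfPoincare`.  Hypotheses as in G3b:
`0 < t < 1`, positive levels with `r·μ_0 ≤ μ_{k+1} ≤ μ_0/r` (`0 < r ≤ 1`), hot update `M_0` with Poincaré constant `γ₀`,
cold updates ARBITRARY row-stochastic `μ_k`-reversible (with `w_k = 0` they are never applied).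

## What is proved

* §1 `whub_swap_flow_ge`, `whub_hot_flow_ge` (`π̃(x)P(x,x^{0←v}) ≥ (1−t)w_0·π̃(x)M_0(x_0,v)`); `ptGraphSwap_ne_zero`,
  `ptGraphSwap_one_sectorCount_eq` (identity maps preserve every sector count).
* §2 **`weightedHub_poincare`** (`C·Var_π̃(f) ≤ 𝓔_π̃(P; f)`, `C` as above); **`weightedHub_spectralGap_ge`**;
  `weightedStar_spectralGap_ge` (`m = K`); `weightedStarIdentical_spectralGap_ge` (`Gap ≥ 1/(6K/t + (3K+1)/(γ₀(1−t)w_0))`).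
* §3 `w = 𝟙_{k=0}`: **`hotOnlyStar_spectralGap_ge_linear`** (`Gap ≥ min{t, γ₀(1−t)}/(10K)`) and the TWO-SIDED LAW
  **`hotOnlyStar_spectralGap_two_sided`**: for every sector `A` with `μ_k(A)μ_k(Aᶜ) ≥ v > 0` at the cold levels,
  `min{t, γ₀(1−t)}/(10K) ≤ Gap(P) ≤ t·min{μ_0(A), μ_0(Aᶜ)}/(K·v)` (the ceiling = H1's `handover_spectralGap_le`; for
  hot-only weights it needs NO frozen-sector hypothesis — the cold replicas are never updated).

Reading (no numerics implied): the power of `K` in the relaxation of an exact exchange sampler over `K` passive cold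
replicas is exactly ONE when the work goes to the replica that tunnels and every cold replica is one accepted swap away
from it; the price of the hub is the direct hot–cold overlap (`r⁴`, `r³` in `C`) — which is what forces LADDERS
(`Θ(K³)`: `Scaling/AdjacentSchemeDiffusiveCeiling` + `Scaling/ReplicaExchangeFrozenColdDirect`) in practice.  NOT
CLAIMED: transport maps on the hub edges; sharp constants; anything measured.  Literature grade (cell rule): OWN
MECHANISM, NEW TYPING; nothing cited as a fact; no new bib keys.
-/
noncomputable section

open Finset Function
open Literature.Probability.MarkovChains

namespace Summit.Ventures.LatticeQCDFlow.Scaling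

variable {S : Type*} [Fintype S] [DecidableEq S] {K : ℕ} {μ : Fin (K + 1) → S → ℝ}
  {M : Fin (K + 1) → S → S → ℝ} {w : Fin (K + 1) → ℝ} {t : ℝ}

/-! ## §1 Flow formulas of the weighted hub scheme; the support of the graph swap -/

/-- **Hub swap flows of the weighted scheme:** for a swap graph `e` (identity maps, distinct endpoints) containing the
hub edge `e_j = (0, k+1)`, weights `w ≥ 0` summing to one, `0 ≤ t ≤ 1`:
`π̃(x)·P(x, x∘τ_k) ≥ (t/m)·min{π̃(x), π̃(x∘τ_k)}` for `x∘τ_k ≠ x`. [ours] -/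
theorem whub_swap_flow_ge {m : ℕ} (e : Fin m → Fin (K + 1) × Fin (K + 1)) (he : ∀ j, (e j).1 ≠ (e j).2)
    (hμ : ∀ k x, 0 < μ k x) (hM : ∀ k, IsRowStochastic (M k)) (hw0 : ∀ k, 0 ≤ w k) (hw1 : ∑ k, w k = 1)
    (ht0 : 0 ≤ t) (ht1 : t ≤ 1) (x : Fin (K + 1) → S) {k : Fin K} {j : Fin m}
    (hj : e j = ((0 : Fin (K + 1)), k.succ)) (hx : x ∘ Equiv.swap (0 : Fin (K + 1)) k.succ ≠ x) :
    t / m * min (tensorFun μ x) (tensorFun μ (x ∘ Equiv.swap (0 : Fin (K + 1)) k.succ))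
      ≤ tensorFun μ x * (t * ptGraphSwap μ e (fun _ : Fin m => Equiv.refl S) x (x ∘ Equiv.swap (0 : Fin (K + 1)) k.succ)
          + (1 - t) * prodKernel w M x (x ∘ Equiv.swap (0 : Fin (K + 1)) k.succ)) := by
  have hU := prodKernel_isRowStochastic M w hw0 hw1 hM
  have hT := ptGraphProposal_edge_ge e (fun _ : Fin m => Equiv.refl S) j x
  rw [hj] at hT; simp only at hT; rw [edgeFlowSwap_one (Fin.succ_ne_zero k).symm] at hT
  rw [mul_add, ← mul_assoc, mul_comm (tensorFun μ x) t, mul_assoc, tensorFun_mul_ptGraphSwap hμ he hx]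
  have hmin : 0 ≤ min (tensorFun μ x) (tensorFun μ (x ∘ Equiv.swap (0 : Fin (K + 1)) k.succ)) :=
    le_min (tensorFun_pos hμ _).le (tensorFun_pos hμ _).le
  have hupd : 0 ≤ tensorFun μ x * ((1 - t) * prodKernel w M x (x ∘ Equiv.swap (0 : Fin (K + 1)) k.succ)) :=
    mul_nonneg (tensorFun_pos hμ x).le (mul_nonneg (by linarith) (hU.1 _ _))
  calc t / m * min (tensorFun μ x) (tensorFun μ (x ∘ Equiv.swap (0 : Fin (K + 1)) k.succ))
      = t * ((1 / m) * min (tensorFun μ x) (tensorFun μ (x ∘ Equiv.swap (0 : Fin (K + 1)) k.succ))) := by ring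
    _ ≤ t * (ptGraphProposal e (fun _ : Fin m => Equiv.refl S) x (x ∘ Equiv.swap (0 : Fin (K + 1)) k.succ)
          * min (tensorFun μ x) (tensorFun μ (x ∘ Equiv.swap (0 : Fin (K + 1)) k.succ))) :=
        mul_le_mul_of_nonneg_left (mul_le_mul_of_nonneg_right hT hmin) ht0
    _ ≤ _ := le_add_of_nonneg_right hupd

/-- **Hot update flows of the weighted scheme:** `π̃(x)·P(x, x^{0←v}) ≥ (1−t)·w_0·π̃(x)M_0(x_0,v)` for `v ≠ x_0`
(`0 ≤ t`; any exchange move `Q ≥ 0`). [ours] -/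
theorem whub_hot_flow_ge {Q : Matrix (Fin (K + 1) → S) (Fin (K + 1) → S) ℝ} (hQ : ∀ x y, 0 ≤ Q x y)
    (hμ : ∀ k x, 0 < μ k x) (ht0 : 0 ≤ t) (x : Fin (K + 1) → S) {v : S} (hv : v ≠ x 0) :
    (1 - t) * w 0 * (tensorFun μ x * M 0 (x 0) v)
      ≤ tensorFun μ x * (t * Q x (update x 0 v) + (1 - t) * prodKernel w M x (update x 0 v)) := by
  rw [prodKernel_update_of_ne _ M x 0 hv]
  have hsw : 0 ≤ t * Q x (update x 0 v) := mul_nonneg ht0 (hQ _ _)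
  calc (1 - t) * w 0 * (tensorFun μ x * M 0 (x 0) v)
      = tensorFun μ x * ((1 - t) * (w 0 * M 0 (x 0) v)) := by ring
    _ ≤ _ := mul_le_mul_of_nonneg_left (le_add_of_nonneg_left hsw) (tensorFun_pos hμ x).le

/-- **The support of the graph swap:** `GSw(x,y) ≠ 0` forces `y = x` or `y` = an edge swap of `x` (edges with distinct
endpoints, positive level laws). [ours] -/
theorem ptGraphSwap_ne_zero {m : ℕ} {e : Fin m → Fin (K + 1) × Fin (K + 1)} (he : ∀ r, (e r).1 ≠ (e r).2)
    {φ : Fin m → Equiv.Perm S} (hμ : ∀ k x, 0 < μ k x) {x y : Fin (K + 1) → S} (hxy : ptGraphSwap μ e φ x y ≠ 0) :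
    y = x ∨ ∃ r, y = edgeFlowSwap (φ r) (e r).1 (e r).2 x := by
  refine or_iff_not_imp_left.mpr fun hyx => ?_
  by_contra hne
  have hT : ptGraphProposal e φ x y = 0 := by
    unfold ptGraphProposal; exact Finset.sum_eq_zero fun r _ => if_neg fun h => hne ⟨r, h⟩
  have h := tensorFun_mul_ptGraphSwap (e := e) (φ := φ) hμ he hyx
  rw [hT, zero_mul] at h
  exact hxy ((mul_eq_zero.mp h).resolve_left (tensorFun_pos hμ x).ne')

/-- **With identity maps the graph swap preserves every sector count:** `GSw(x,y) ≠ 0 ⇒ #{k : y_k ∈ A} = #{k : x_k ∈ A}`.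
[ours] -/
theorem ptGraphSwap_one_sectorCount_eq {m : ℕ} {e : Fin m → Fin (K + 1) × Fin (K + 1)} (he : ∀ r, (e r).1 ≠ (e r).2)
    (hμ : ∀ k x, 0 < μ k x) (A : Finset S) (x y : Fin (K + 1) → S)
    (hxy : ptGraphSwap μ e (fun _ : Fin m => Equiv.refl S) x y ≠ 0) :
    ∑ k, (if y k ∈ A then (1 : ℝ) else 0) = ∑ k, (if x k ∈ A then (1 : ℝ) else 0) := by
  rcases ptGraphSwap_ne_zero he hμ hxy with h | ⟨r, hr⟩
  · rw [h]
  · rw [hr, edgeFlowSwap_one (he r)]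
    exact Equiv.sum_comp (Equiv.swap (e r).1 (e r).2) (fun k => if x k ∈ A then (1 : ℝ) else 0)

/-! ## §2 The weighted hub Poincaré inequality and the gap floors -/
set_option maxHeartbeats 400000 in -- buildfix (bf3-g25): 160k/180k FAIL, 200k PASS at accept time; line-neutral budget line
/-- **THE WEIGHTED HUB POINCARÉ INEQUALITY:** for a swap graph with `m ≥ 1` edges (identity maps, distinct endpoints)
containing every hub edge `(0, k+1)`, update weights `w ≥ 0`, `Σ w = 1`, `w_0 > 0`:
`C·Var_π̃(f) ≤ 𝓔_π̃(P; f)` with `C = 1/(3m(r²+1)/(t r⁴) + (r³+3K)/(r³γ₀(1−t)w_0))` — two-sided ratio `r`, hot Poincaré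
constant `γ₀`, arbitrary cold updates. [ours] -/
theorem weightedHub_poincare {m : ℕ} (hm : 1 ≤ m) (e : Fin m → Fin (K + 1) × Fin (K + 1)) (he : ∀ j, (e j).1 ≠ (e j).2)
    (hhub : ∀ k : Fin K, ∃ j, e j = ((0 : Fin (K + 1)), k.succ)) (hμ : ∀ k x, 0 < μ k x)
    (hμ1 : ∀ k, ∑ u, μ k u = 1) (hM : ∀ k, IsRowStochastic (M k)) (hw0 : ∀ k, 0 ≤ w k) (hw1 : ∑ k, w k = 1)
    (hwhot : 0 < w 0) (ht0 : 0 < t) (ht1 : t < 1) {r γ₀ : ℝ} (hr : 0 < r) (hr1 : r ≤ 1) (hγ₀ : 0 < γ₀)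
    (hrc : ∀ (k : Fin K) (u : S), r * μ 0 u ≤ μ k.succ u) (hrh : ∀ (k : Fin K) (u : S), r * μ k.succ u ≤ μ 0 u)
    (hgap0 : ∀ h : S → ℝ, γ₀ * lawVariance (μ 0) h ≤ dirichletForm (μ 0) (M 0) h) (f : (Fin (K + 1) → S) → ℝ) :
    1 / (3 * m * (r ^ 2 + 1) / (t * r ^ 4) + (r ^ 3 + 3 * K) / (r ^ 3 * γ₀ * (1 - t) * w 0))
        * lawVariance (tensorFun μ) f
      ≤ dirichletForm (tensorFun μ) (fun x y : Fin (K + 1) → S =>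
          t * ptGraphSwap μ e (fun _ : Fin m => Equiv.refl S) x y + (1 - t) * prodKernel w M x y) f := by
  set P : Matrix (Fin (K + 1) → S) (Fin (K + 1) → S) ℝ := fun x y =>
    t * ptGraphSwap μ e (fun _ : Fin m => Equiv.refl S) x y + (1 - t) * prodKernel w M x y with hP
  have hmpos : (0 : ℝ) < m := Nat.cast_pos.mpr (by omega)
  have hGS0 : ∀ x y, 0 ≤ ptGraphSwap μ e (fun _ : Fin m => Equiv.refl S) x y := (ptGraphSwap_isRowStochastic hμ).1
  have hP0 : ∀ x y, 0 ≤ P x y :=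
    (weightedScheme_isRowStochastic (ptGraphSwap_isRowStochastic hμ) hM hw0 hw1 ht0.le ht1.le).1
  have hπ0 : ∀ x, 0 ≤ tensorFun μ x := fun x => (tensorFun_pos hμ x).le
  set W : Fin K → ℝ := fun k => ∑ x : Fin (K + 1) → S, tensorFun μ x
    * (f x - f (x ∘ Equiv.swap (0 : Fin (K + 1)) k.succ)) ^ 2 with hW
  set Sk : Fin K → ℝ := fun k => ∑ x : Fin (K + 1) → S, tensorFun μ x * P x (x ∘ Equiv.swap (0 : Fin (K + 1)) k.succ)
    * (f x - f (x ∘ Equiv.swap (0 : Fin (K + 1)) k.succ)) ^ 2 with hSk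
  set U : ℝ := ∑ x : Fin (K + 1) → S, ∑ v, tensorFun μ x * M 0 (x 0) v * (f x - f (update x 0 v)) ^ 2 with hU
  set H : ℝ := (1 / 2) * ∑ x : Fin (K + 1) → S, ∑ v, tensorFun μ x * P x (update x 0 v) * (f x - f (update x 0 v)) ^ 2
    with hH
  set E := dirichletForm (tensorFun μ) P f with hE
  -- (F5) `W_k ≤ (m/(t r²))·S_k`
  have F5 : ∀ k, W k ≤ m / (t * r ^ 2) * Sk k := by
    intro k
    obtain ⟨j, hj⟩ := hhub k
    rw [hW, hSk]; simp only; rw [Finset.mul_sum]; refine sum_le_sum fun x _ => ?_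
    by_cases hx : x ∘ Equiv.swap (0 : Fin (K + 1)) k.succ = x
    · rw [hx, sub_self]; simp
    · have hflow := whub_swap_flow_ge (M := M) (w := w) e he hμ hM hw0 hw1 ht0.le ht1.le x hj hx
      have hr2 := tensorFun_comp_swap_zero_succ_ge hμ hr.le hrc hrh x k
      have hmin : r ^ 2 * tensorFun μ x ≤ min (tensorFun μ x) (tensorFun μ (x ∘ Equiv.swap (0 : Fin (K + 1)) k.succ)) :=
        le_min (by nlinarith [tensorFun_pos hμ x, pow_le_one₀ (n := 2) hr.le hr1]) hr2
      have key : t / m * (r ^ 2 * tensorFun μ x) ≤ tensorFun μ x * P x (x ∘ Equiv.swap (0 : Fin (K + 1)) k.succ) :=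
        le_trans (mul_le_mul_of_nonneg_left hmin (by positivity)) hflow
      have hsq := sq_nonneg (f x - f (x ∘ Equiv.swap (0 : Fin (K + 1)) k.succ))
      calc tensorFun μ x * (f x - f (x ∘ Equiv.swap (0 : Fin (K + 1)) k.succ)) ^ 2
          = m / (t * r ^ 2) * (t / m * (r ^ 2 * tensorFun μ x))
            * (f x - f (x ∘ Equiv.swap (0 : Fin (K + 1)) k.succ)) ^ 2 := by field_simp
        _ ≤ m / (t * r ^ 2) * (tensorFun μ x * P x (x ∘ Equiv.swap (0 : Fin (K + 1)) k.succ))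
            * (f x - f (x ∘ Equiv.swap (0 : Fin (K + 1)) k.succ)) ^ 2 :=
          mul_le_mul_of_nonneg_right (mul_le_mul_of_nonneg_left key (by positivity)) hsq
        _ = _ := by ring
  -- (F6) `U ≤ (2/((1−t)w_0))·H`
  have h1t : 0 < 1 - t := by linarith
  have F6 : U ≤ 2 / ((1 - t) * w 0) * H := by
    rw [hU, hH, ← mul_assoc, show 2 / ((1 - t) * w 0) * (1 / 2) = 1 / ((1 - t) * w 0) by ring, Finset.mul_sum]
    refine sum_le_sum fun x _ => ?_; rw [Finset.mul_sum]; refine sum_le_sum fun v _ => ?_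
    by_cases hv : v = x 0
    · rw [hv, update_eq_self, sub_self]; simp
    · have hflow := whub_hot_flow_ge (M := M) (w := w) hGS0 hμ ht0.le x hv
      have hsq := sq_nonneg (f x - f (update x 0 v))
      calc tensorFun μ x * M 0 (x 0) v * (f x - f (update x 0 v)) ^ 2
          = 1 / ((1 - t) * w 0) * ((1 - t) * w 0 * (tensorFun μ x * M 0 (x 0) v)) * (f x - f (update x 0 v)) ^ 2 := by
            field_simp
        _ ≤ 1 / ((1 - t) * w 0) * (tensorFun μ x * P x (update x 0 v)) * (f x - f (update x 0 v)) ^ 2 :=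
            mul_le_mul_of_nonneg_right (mul_le_mul_of_nonneg_left hflow (by positivity)) hsq
        _ = _ := by ring
  -- (F7) kept flows
  have F7a : (1 / 2) * ∑ k, Sk k ≤ E := by
    rw [hSk, hE]; exact half_sum_starSwap_le_dirichletForm hπ0 hP0 f
  have F7b : H ≤ E := by rw [hH, hE]; exact half_sum_relabel_le_dirichletForm hπ0 hP0 f
  -- Efron–Stein and the legs
  have ES := efronStein_tensorFun (ν := μ) (fun k u => (hμ k u).le) hμ1 f
  rw [Fin.sum_univ_succ] at ES
  have B0 : (1 / 2) * ∑ x : Fin (K + 1) → S, ∑ v, tensorFun μ x * μ 0 v * (f x - f (update x 0 v)) ^ 2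
      ≤ 1 / (2 * γ₀) * U := by
    have h := star_hot_variance_le (μ := μ) hμ1 (fun k u => (hμ k u).le) hγ₀ hgap0 f
    rw [hU]
    calc (1 / 2) * ∑ x : Fin (K + 1) → S, ∑ v, tensorFun μ x * μ 0 v * (f x - f (update x 0 v)) ^ 2
        ≤ (1 / 2) * (1 / γ₀ * ∑ y : Fin (K + 1) → S, ∑ v, tensorFun μ y * M 0 (y 0) v * (f y - f (update y 0 v)) ^ 2) :=
          mul_le_mul_of_nonneg_left h (by norm_num)
      _ = _ := by ring
  have Bk : ∀ k : Fin K, (1 / 2) * ∑ x : Fin (K + 1) → S, ∑ v, tensorFun μ x * μ k.succ v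
      * (f x - f (update x k.succ v)) ^ 2 ≤ 3 / 2 * ((1 + 1 / r ^ 2) * W k + 1 / (r ^ 3 * γ₀) * U) := by
    intro k
    have L1 := star_leg_swap (μ := μ) hμ1 f k
    have L2 := star_leg_hot_le (μ := μ) hμ hμ1 hr hr1 hγ₀ hrc hrh hgap0 f k
    have L3 := star_leg_back_le (μ := μ) hμ hμ1 hr hrc hrh f k
    have split : ∀ (x : Fin (K + 1) → S) (v : S), tensorFun μ x * μ k.succ v * (f x - f (update x k.succ v)) ^ 2
        ≤ 3 * (tensorFun μ x * μ k.succ v * (f x - f (x ∘ Equiv.swap (0 : Fin (K + 1)) k.succ)) ^ 2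
          + tensorFun μ x * μ k.succ v * (f (x ∘ Equiv.swap (0 : Fin (K + 1)) k.succ)
              - f (update (x ∘ Equiv.swap (0 : Fin (K + 1)) k.succ) 0 v)) ^ 2
          + tensorFun μ x * μ k.succ v * (f (update (x ∘ Equiv.swap (0 : Fin (K + 1)) k.succ) 0 v)
              - f ((update (x ∘ Equiv.swap (0 : Fin (K + 1)) k.succ) 0 v) ∘ Equiv.swap (0 : Fin (K + 1)) k.succ)) ^ 2) := by
      intro x v
      rw [update_succ_eq_conj_swap x k v]
      have hw : 0 ≤ tensorFun μ x * μ k.succ v := mul_nonneg (hπ0 x) (hμ _ _).le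
      have h3 := mul_sq_add_add_le_three hw (f x - f (x ∘ Equiv.swap (0 : Fin (K + 1)) k.succ))
        (f (x ∘ Equiv.swap (0 : Fin (K + 1)) k.succ) - f (update (x ∘ Equiv.swap (0 : Fin (K + 1)) k.succ) 0 v))
        (f (update (x ∘ Equiv.swap (0 : Fin (K + 1)) k.succ) 0 v)
          - f ((update (x ∘ Equiv.swap (0 : Fin (K + 1)) k.succ) 0 v) ∘ Equiv.swap (0 : Fin (K + 1)) k.succ))
      have e : f x - f ((update (x ∘ Equiv.swap (0 : Fin (K + 1)) k.succ) 0 v) ∘ Equiv.swap (0 : Fin (K + 1)) k.succ)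
          = (f x - f (x ∘ Equiv.swap (0 : Fin (K + 1)) k.succ))
            + (f (x ∘ Equiv.swap (0 : Fin (K + 1)) k.succ) - f (update (x ∘ Equiv.swap (0 : Fin (K + 1)) k.succ) 0 v))
            + (f (update (x ∘ Equiv.swap (0 : Fin (K + 1)) k.succ) 0 v)
              - f ((update (x ∘ Equiv.swap (0 : Fin (K + 1)) k.succ) 0 v) ∘ Equiv.swap (0 : Fin (K + 1)) k.succ)) := by
        ring
      rw [e]
      nlinarith [h3]
    have hsum := sum_le_sum fun x (_ : x ∈ (univ : Finset (Fin (K + 1) → S))) =>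
      sum_le_sum fun v (_ : v ∈ (univ : Finset S)) => split x v
    simp only [Finset.sum_add_distrib, ← Finset.mul_sum] at hsum; rw [L1] at hsum
    nlinarith [hsum, L2, L3, (by positivity : 0 < r ^ 2)]
  -- assemble
  set A : ℝ := 3 * m * (r ^ 2 + 1) / (t * r ^ 4) with hA
  set B : ℝ := (r ^ 3 + 3 * K) / (r ^ 3 * γ₀ * (1 - t) * w 0) with hB
  have hAB : 0 < A + B := add_pos (by positivity) (div_pos (by positivity) (mul_pos (mul_pos (by positivity) h1t) hwhot))
  have hE0 : 0 ≤ E := by rw [hE]; exact dirichletForm_nonneg hπ0 hP0 f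
  set c1 : ℝ := 3 / 2 * (1 + 1 / r ^ 2) * (m / (t * r ^ 2)) with hc1
  set c2 : ℝ := 3 / 2 * (1 / (r ^ 3 * γ₀)) with hc2
  have hc1pos : 0 ≤ c1 := by positivity
  have step2 : ∀ k : Fin K, (1 / 2) * ∑ x : Fin (K + 1) → S, ∑ v, tensorFun μ x * μ k.succ v
      * (f x - f (update x k.succ v)) ^ 2 ≤ c1 * Sk k + c2 * U := by
    intro k
    have := mul_le_mul_of_nonneg_left (F5 k) (by positivity : (0 : ℝ) ≤ 3 / 2 * (1 + 1 / r ^ 2))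
    rw [hc1, hc2]; nlinarith [Bk k, this]
  have step3 : ∑ k : Fin K, (1 / 2) * ∑ x : Fin (K + 1) → S, ∑ v, tensorFun μ x * μ k.succ v
      * (f x - f (update x k.succ v)) ^ 2 ≤ c1 * ∑ k, Sk k + K * (c2 * U) := by
    calc ∑ k : Fin K, (1 / 2) * ∑ x : Fin (K + 1) → S, ∑ v, tensorFun μ x * μ k.succ v
          * (f x - f (update x k.succ v)) ^ 2
        ≤ ∑ k : Fin K, (c1 * Sk k + c2 * U) := sum_le_sum fun k _ => step2 k
      _ = c1 * ∑ k, Sk k + K * (c2 * U) := by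
          rw [Finset.sum_add_distrib, Finset.sum_const, Finset.card_univ, Fintype.card_fin, nsmul_eq_mul,
            ← Finset.mul_sum]
  have hSsum : ∑ k, Sk k ≤ 2 * E := by linarith [F7a]
  have hUH : U ≤ 2 / ((1 - t) * w 0) * E :=
    le_trans F6 (mul_le_mul_of_nonneg_left F7b (div_nonneg (by norm_num) (mul_pos h1t hwhot).le))
  have hc2' : 0 ≤ 1 / (2 * γ₀) + K * c2 := by positivity
  have hVar : lawVariance (tensorFun μ) f ≤ (A + B) * E :=
    calc lawVariance (tensorFun μ) f
        ≤ 1 / (2 * γ₀) * U + (c1 * ∑ k, Sk k + K * (c2 * U)) := le_trans ES (add_le_add B0 step3)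
      _ = c1 * ∑ k, Sk k + (1 / (2 * γ₀) + K * c2) * U := by ring
      _ ≤ c1 * (2 * E) + (1 / (2 * γ₀) + K * c2) * (2 / ((1 - t) * w 0) * E) :=
          add_le_add (mul_le_mul_of_nonneg_left hSsum hc1pos) (mul_le_mul_of_nonneg_left hUH hc2')
      _ = (A + B) * E := by
          rw [hA, hB, hc1, hc2]
          field_simp
  rw [hA, hB] at hVar hAB
  rw [one_div, inv_mul_le_iff₀ hAB]; exact hVar

/-- **THE WEIGHTED HUB FLOOR: `Gap(P) ≥ 1/(3m(r²+1)/(t r⁴) + (r³+3K)/(r³γ₀(1−t)w_0))`** for every swap graph with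
`m ≥ 1` edges (identity maps, distinct endpoints) containing the hub edges, every allocation `w` of the updates with
`w_0 > 0` (`0 < t < 1`, `|S| ≥ 2`, cold updates arbitrary `μ_k`-reversible). [ours] -/
theorem weightedHub_spectralGap_ge [Nontrivial S] {m : ℕ} (hm : 1 ≤ m) (e : Fin m → Fin (K + 1) × Fin (K + 1))
    (he : ∀ j, (e j).1 ≠ (e j).2) (hhub : ∀ k : Fin K, ∃ j, e j = ((0 : Fin (K + 1)), k.succ))
    (hμ : ∀ k x, 0 < μ k x) (hμ1 : ∀ k, ∑ u, μ k u = 1) (hM : ∀ k, IsRowStochastic (M k))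
    (hMrev : ∀ k, DetailedBalance (μ k) (M k)) (hw0 : ∀ k, 0 ≤ w k) (hw1 : ∑ k, w k = 1) (hwhot : 0 < w 0)
    (ht0 : 0 < t) (ht1 : t < 1) {r γ₀ : ℝ} (hr : 0 < r) (hr1 : r ≤ 1) (hγ₀ : 0 < γ₀)
    (hrc : ∀ (k : Fin K) (u : S), r * μ 0 u ≤ μ k.succ u) (hrh : ∀ (k : Fin K) (u : S), r * μ k.succ u ≤ μ 0 u)
    (hgap0 : ∀ h : S → ℝ, γ₀ * lawVariance (μ 0) h ≤ dirichletForm (μ 0) (M 0) h) :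
    1 / (3 * m * (r ^ 2 + 1) / (t * r ^ 4) + (r ^ 3 + 3 * K) / (r ^ 3 * γ₀ * (1 - t) * w 0))
      ≤ spectralGap (tensorFun μ) (fun x y : Fin (K + 1) → S =>
          t * ptGraphSwap μ e (fun _ : Fin m => Equiv.refl S) x y + (1 - t) * prodKernel w M x y) :=
  le_spectralGap_of_poincare (tensorFun_pos hμ) (sum_tensorFun_eq_one μ hμ1)
    (weightedScheme_isRowStochastic (ptGraphSwap_isRowStochastic hμ) hM hw0 hw1 ht0.le ht1.le)
    (weightedScheme_detailedBalance (ptGraphSwap_detailedBalance hμ) hMrev t)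
    (weightedHub_poincare hm e he hhub hμ hμ1 hM hw0 hw1 hwhot ht0 ht1 hr hr1 hγ₀ hrc hrh hgap0)

/-- **THE WEIGHTED STAR FLOOR** (edges `(0, k+1)`, `m = K ≥ 1`):
`Gap(P) ≥ 1/(3K(r²+1)/(t r⁴) + (r³+3K)/(r³γ₀(1−t)w_0))`. [ours] -/
theorem weightedStar_spectralGap_ge [Nontrivial S] (hK : 1 ≤ K) (hμ : ∀ k x, 0 < μ k x) (hμ1 : ∀ k, ∑ u, μ k u = 1)
    (hM : ∀ k, IsRowStochastic (M k)) (hMrev : ∀ k, DetailedBalance (μ k) (M k)) (hw0 : ∀ k, 0 ≤ w k)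
    (hw1 : ∑ k, w k = 1) (hwhot : 0 < w 0) (ht0 : 0 < t) (ht1 : t < 1) {r γ₀ : ℝ} (hr : 0 < r) (hr1 : r ≤ 1)
    (hγ₀ : 0 < γ₀) (hrc : ∀ (k : Fin K) (u : S), r * μ 0 u ≤ μ k.succ u)
    (hrh : ∀ (k : Fin K) (u : S), r * μ k.succ u ≤ μ 0 u)
    (hgap0 : ∀ h : S → ℝ, γ₀ * lawVariance (μ 0) h ≤ dirichletForm (μ 0) (M 0) h) :
    1 / (3 * K * (r ^ 2 + 1) / (t * r ^ 4) + (r ^ 3 + 3 * K) / (r ^ 3 * γ₀ * (1 - t) * w 0))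
      ≤ spectralGap (tensorFun μ) (fun x y : Fin (K + 1) → S =>
          t * ptGraphSwap μ (fun k : Fin K => ((0 : Fin (K + 1)), k.succ)) (fun _ : Fin K => Equiv.refl S) x y
            + (1 - t) * prodKernel w M x y) :=
  weightedHub_spectralGap_ge hK (fun k : Fin K => ((0 : Fin (K + 1)), k.succ)) (fun k => (Fin.succ_ne_zero k).symm)
    (fun k => ⟨k, rfl⟩) hμ hμ1 hM hMrev hw0 hw1 hwhot ht0 ht1 hr hr1 hγ₀ hrc hrh hgap0

/-- **IDENTICAL LEVELS, ANY WEIGHTS:** `Gap(P) ≥ 1/(6K/t + (3K+1)/(γ₀(1−t)w_0))` for the weighted star with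
`μ_k = μ_0`. [ours] -/
theorem weightedStarIdentical_spectralGap_ge [Nontrivial S] (hK : 1 ≤ K) (hμ : ∀ k x, 0 < μ k x)
    (hμ1 : ∀ k, ∑ u, μ k u = 1) (hM : ∀ k, IsRowStochastic (M k)) (hMrev : ∀ k, DetailedBalance (μ k) (M k))
    (hw0 : ∀ k, 0 ≤ w k) (hw1 : ∑ k, w k = 1) (hwhot : 0 < w 0) (ht0 : 0 < t) (ht1 : t < 1)
    (hsame : ∀ k, μ k = μ 0) {γ₀ : ℝ} (hγ₀ : 0 < γ₀)
    (hgap0 : ∀ h : S → ℝ, γ₀ * lawVariance (μ 0) h ≤ dirichletForm (μ 0) (M 0) h) :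
    1 / (6 * K / t + (3 * K + 1) / (γ₀ * (1 - t) * w 0))
      ≤ spectralGap (tensorFun μ) (fun x y : Fin (K + 1) → S =>
          t * ptGraphSwap μ (fun k : Fin K => ((0 : Fin (K + 1)), k.succ)) (fun _ : Fin K => Equiv.refl S) x y
            + (1 - t) * prodKernel w M x y) := by
  have h := weightedStar_spectralGap_ge (t := t) (M := M) (w := w) (r := 1) hK hμ hμ1 hM hMrev hw0 hw1 hwhot ht0 ht1
    one_pos le_rfl hγ₀ (fun k u => by rw [hsame k.succ, one_mul]) (fun k u => by rw [hsame k.succ, one_mul]) hgap0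
  have e : 3 * (K : ℝ) * ((1 : ℝ) ^ 2 + 1) / (t * 1 ^ 4) + (1 ^ 3 + 3 * K) / (1 ^ 3 * γ₀ * (1 - t) * w 0)
      = 6 * K / t + (3 * K + 1) / (γ₀ * (1 - t) * w 0) := by ring
  exact e ▸ h

/-! ## §3 Hot-only updates: the linear law, two-sided -/

omit [Fintype S] [DecidableEq S] in
/-- The hot-only weight vector `𝟙_{k=0}` is a probability vector. [ours] -/
theorem hotOnlyWeight_sum : ∑ k : Fin (K + 1), (if k = 0 then (1 : ℝ) else 0) = 1 := by
  rw [Finset.sum_ite_eq' univ (0 : Fin (K + 1)), if_pos (mem_univ _)]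

/-- **THE LINEAR LAW IS ATTAINED: `Gap(P) ≥ min{t, γ₀(1−t)}/(10K)`** for the star with every update spent on the
hot replica (`w = 𝟙_{k=0}`: the cold replicas are never updated) and identical levels (`K ≥ 1`, `0 < t < 1`); from
`weightedStarIdentical_spectralGap_ge`: `Gap ≥ 1/(6K/t + (3K+1)/(γ₀(1−t))) ≥ min{t,γ₀(1−t)}/(10K)`. [ours] -/
theorem hotOnlyStar_spectralGap_ge_linear [Nontrivial S] (hK : 1 ≤ K) (hμ : ∀ k x, 0 < μ k x)
    (hμ1 : ∀ k, ∑ u, μ k u = 1) (hM : ∀ k, IsRowStochastic (M k)) (hMrev : ∀ k, DetailedBalance (μ k) (M k))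
    (ht0 : 0 < t) (ht1 : t < 1) (hsame : ∀ k, μ k = μ 0) {γ₀ : ℝ} (hγ₀ : 0 < γ₀)
    (hgap0 : ∀ h : S → ℝ, γ₀ * lawVariance (μ 0) h ≤ dirichletForm (μ 0) (M 0) h) :
    min t (γ₀ * (1 - t)) / (10 * K)
      ≤ spectralGap (tensorFun μ) (fun x y : Fin (K + 1) → S =>
          t * ptGraphSwap μ (fun k : Fin K => ((0 : Fin (K + 1)), k.succ)) (fun _ : Fin K => Equiv.refl S) x y
            + (1 - t) * prodKernel (fun k : Fin (K + 1) => if k = 0 then (1 : ℝ) else 0) M x y) := by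
  have h := weightedStarIdentical_spectralGap_ge (t := t) (M := M)
    (w := fun k : Fin (K + 1) => if k = 0 then (1 : ℝ) else 0) hK hμ hμ1 hM hMrev
    (fun k => by positivity) hotOnlyWeight_sum (by simp) ht0 ht1 hsame hγ₀ hgap0
  simp only [if_true, mul_one] at h
  refine le_trans ?_ h
  have hKr : (1 : ℝ) ≤ K := by exact_mod_cast hK
  have h1t : 0 < 1 - t := by linarith
  set m' := min t (γ₀ * (1 - t)) with hm'
  have hm'pos : 0 < m' := lt_min ht0 (mul_pos hγ₀ h1t)
  -- `6K/t ≤ 6K/m'` and `(3K+1)/(γ₀(1−t)) ≤ 4K/m'`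
  have h1 : 6 * K / t ≤ 6 * K / m' := div_le_div_of_nonneg_left (by positivity) hm'pos (min_le_left _ _)
  have h2 : (3 * K + 1) / (γ₀ * (1 - t)) ≤ 4 * K / m' :=
    calc (3 * K + 1) / (γ₀ * (1 - t)) ≤ (4 * K) / (γ₀ * (1 - t)) :=
          div_le_div_of_nonneg_right (by linarith) (mul_pos hγ₀ h1t).le
      _ ≤ 4 * K / m' := div_le_div_of_nonneg_left (by positivity) hm'pos (min_le_right _ _)
  have hden : 0 < 6 * K / t + (3 * K + 1) / (γ₀ * (1 - t)) := by positivity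
  calc m' / (10 * K) = 1 / (6 * K / m' + 4 * K / m') := by field_simp; ring
    _ ≤ 1 / (6 * K / t + (3 * K + 1) / (γ₀ * (1 - t))) := one_div_le_one_div_of_le hden (add_le_add h1 h2)

/-- **THE TWO-SIDED LINEAR LAW FOR THE HOT-ONLY STAR:** identical levels, hot Poincaré constant `γ₀`, and a sector `A`
with `μ_k(A)μ_k(Aᶜ) ≥ v > 0` at every cold level:
`min{t, γ₀(1−t)}/(10K) ≤ Gap(P) ≤ t·min{μ_0(A), μ_0(Aᶜ)}/(K·v)` — the floor of this file against the handover
ceiling of `Scaling/ExchangeSchemeHandoverCeiling` (no frozen-sector hypothesis is needed for the ceiling: with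
`w = 𝟙_{k=0}` the cold replicas are never updated). [ours] -/
theorem hotOnlyStar_spectralGap_two_sided [Nontrivial S] (hK : 1 ≤ K) (hμ : ∀ k x, 0 < μ k x)
    (hμ1 : ∀ k, ∑ u, μ k u = 1) (hM : ∀ k, IsRowStochastic (M k)) (hMrev : ∀ k, DetailedBalance (μ k) (M k))
    (ht0 : 0 < t) (ht1 : t < 1) (hsame : ∀ k, μ k = μ 0) {γ₀ : ℝ} (hγ₀ : 0 < γ₀)
    (hgap0 : ∀ h : S → ℝ, γ₀ * lawVariance (μ 0) h ≤ dirichletForm (μ 0) (M 0) h) {A : Finset S} {v : ℝ}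
    (hvpos : 0 < v) (hv : ∀ k : Fin (K + 1), k ≠ 0 → v ≤ (∑ u ∈ A, μ k u) * ∑ u ∈ Aᶜ, μ k u) :
    min t (γ₀ * (1 - t)) / (10 * K)
        ≤ spectralGap (tensorFun μ) (fun x y : Fin (K + 1) → S =>
            t * ptGraphSwap μ (fun k : Fin K => ((0 : Fin (K + 1)), k.succ)) (fun _ : Fin K => Equiv.refl S) x y
              + (1 - t) * prodKernel (fun k : Fin (K + 1) => if k = 0 then (1 : ℝ) else 0) M x y)
      ∧ spectralGap (tensorFun μ) (fun x y : Fin (K + 1) → S =>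
            t * ptGraphSwap μ (fun k : Fin K => ((0 : Fin (K + 1)), k.succ)) (fun _ : Fin K => Equiv.refl S) x y
              + (1 - t) * prodKernel (fun k : Fin (K + 1) => if k = 0 then (1 : ℝ) else 0) M x y)
          ≤ t * min (∑ u ∈ A, μ 0 u) (∑ u ∈ Aᶜ, μ 0 u) / (K * v) := by
  refine ⟨hotOnlyStar_spectralGap_ge_linear hK hμ hμ1 hM hMrev ht0 ht1 hsame hγ₀ hgap0, ?_⟩
  set e : Fin K → Fin (K + 1) × Fin (K + 1) := fun k => ((0 : Fin (K + 1)), k.succ) with he_def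
  have he : ∀ j, (e j).1 ≠ (e j).2 := fun k => (Fin.succ_ne_zero k).symm
  have hQ := ptGraphSwap_isRowStochastic (e := e) (φ := fun _ : Fin K => Equiv.refl S) hμ
  have hQrev := ptGraphSwap_detailedBalance (e := e) (φ := fun _ : Fin K => Equiv.refl S) hμ
  have hQA := ptGraphSwap_one_sectorCount_eq (e := e) he hμ A
  have hKpos : (0 : ℝ) < K := Nat.cast_pos.mpr (by omega)
  have hVge := coldSectorMass_ge (μ := μ) (A := A) hv
  have hw0 : ∀ k : Fin (K + 1), 0 ≤ (if k = 0 then (1 : ℝ) else 0) := fun k => by positivity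
  have h := handover_spectralGap_le (w := fun k : Fin (K + 1) => if k = 0 then (1 : ℝ) else 0) hμ hμ1 hM hMrev hw0
    hotOnlyWeight_sum ht0.le ht1.le hQ hQrev hQA (lt_of_lt_of_le (mul_pos hKpos hvpos) hVge)
  have hU0 : ∑ k : Fin (K + 1), (if k = 0 then (1 : ℝ) else 0)
      * (if k = 0 then (0 : ℝ) else edgeMeasure (μ k) (M k) A Aᶜ) = 0 :=
    Finset.sum_eq_zero fun k _ => by by_cases hk : k = 0 <;> simp [hk]
  rw [hU0, mul_zero, add_zero] at h
  have hη0 : 0 ≤ t * edgeMeasure (tensorFun μ) (ptGraphSwap μ e fun _ : Fin K => Equiv.refl S)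
      (univ.filter (fun x : Fin (K + 1) → S => x 0 ∈ A)) (univ.filter (fun x : Fin (K + 1) → S => x 0 ∈ A))ᶜ :=
    mul_nonneg ht0.le (edgeMeasure_nonneg (fun x => (tensorFun_pos hμ x).le) hQ.1 _ _)
  refine (h.trans (div_le_div_of_nonneg_left hη0 (by positivity) hVge)).trans ?_
  refine div_le_div_of_nonneg_right (mul_le_mul_of_nonneg_left (le_min ?_ ?_) ht0.le) (by positivity)
  · exact handoverFlow_le_hot hμ hμ1 hQ A
  · exact handoverFlow_le_hot_compl hμ hμ1 hQ hQrev A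

end Summit.Ventures.LatticeQCDFlow.Scaling

end
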